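import Literature.AlgebraicGeometry.AbelianSchemes.AbelianSchemeEndomorphismOfHolomorphicMap
import Literature.AlgebraicGeometry.AbelianSchemes.AbelianSchemeDualTransportUnit
import Literature.Geometry.ComplexAnalytic.MarkedFamilyHomGluing
import Literature.Geometry.Kaehler.ComplexTorusHomLift
import HarnessLib

/-!
# An endomorphism of an abelian scheme over a smooth complex base from COMPATIBLE CHART READINGS: period-preserving holomorphic
# linear families in relative exponential charts covering the base give ONE algebraic endomorphism
# ([BirkenhakeLange2004] §1.2 Prop. 1.2.1; [Shimura1963AnalyticFamilies] §2; [SerreGAGA1956] §3 Prop. 15; [MumfordFogartyKirwan1994] Ch. 6 §1 Cor. 6.4)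

Topic `Literature/AlgebraicGeometry/AbelianSchemes`, namespace `Literature.AlgebraicGeometry.AbelianSchemes.AbelianSchemeOver`.
THEOREMS ONLY (no definition, no named fact, no instance, no notation, no `sorry`).  Cell `hodgecm-mathlib` (D-0151), FLOOR 0, P6
«MOD» (crux hLiu418 = stmt-HodgeConjecture-24832, `--supports`), organ **E6-an′ «ENDOMORPHISM OF CHART READINGS»** (E6 heir A-p06 (g33)):
the assembly of ★ U6-b′ `IsRelExpChartOn.exists_mdifferentiable_of_cover` (glue the chartwise holomorphic maps of ★ U6-b
`MarkedFamilyHomCriterion`) with ★ E6-an `exists_isMonHom_of_mdifferentiable` (GAGA + rigidity) — the generic heart of the E6 closer՚s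
analytic socket Σ-ℂ `ReadsC` of `Cruxes/HLiu418/Lines/F0_P6a_PELWitnessE.lean` (`stub_E6`): there the charts are the ★ P-3
`siegelUniversalFamilyUniformisation` charts of the pulled-back universal family over the lift domains of the analytified record curve and
the linear families are the `ℂ`-linear avatars of the lattice reading `Mρ a b` (★ `AuxChartGS.Mρ_kottwitz`); this file is what turns
«compatible readings on a cover» into «an endomorphism of the abelian scheme `P.A ×_X X_ℂ`».  HC_CM is proved only modulo the printed
citations until rung 0 closes; this file is generic and changes no count.

THE MATHEMATICS.  `S` a smooth separated complex variety (reduced, locally of finite type), `A → S` an abelian scheme with smooth projective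
total space `T` (★ `isSmoothProjective_total`), analytifications `φS : MS → S(ℂ)`, `φA : MA → T(ℂ)` and the analytic projection
`p := basePoint : MA → MS` (★ `ComplexAnalytic.basePoint`).  Suppose `MS` is COVERED by opens `U_i` carrying relative exponential charts
`(Φ_i, ex_i)` of `p` (★ `IsRelExpChartOn`) whose zero `ex_i (t, 0)` is the zero `ε(φS t)` of the fibre, and holomorphic families
`C_i t : E_g →L[ℂ] E_g` on `U_i` carrying periods to periods (`C_i t ∘ Φ_i t = Φ_i t ∘ N_i t` on `ℤ^ι`) which are COMPATIBLE ON THE FIBRES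
(`ex_i (t, z) = ex_j (t, z′) ⟹ ex_i (t, C_i t z) = ex_j (t, C_j t z′)`).  Then (§2) there is an `S`-ENDOMORPHISM `Y : A → A`, a HOMOMORPHISM,
inducing every chart recipe: `φA (ex_i (t, C_i t z)) = φA (ex_i (t, z)) ≫ Y`.  Proof: glue the chartwise maps (★ U6-b′) to a holomorphic
`y : MA → MA` over `MS`; it lies over `S` on points (`p ∘ y = p`), and it fixes the zero section (a point of `MA` on the zero section is the
chart zero `ex_i (t, 0)` — `φA` is injective and a fibre point is determined by its point of `A` — and `C_i t 0 = 0`); ★ E6-an does the rest.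
§3 is the same with the zero hypothesis in the (G)-clause form of ★ P-1 ∕ ★ P-3 («the fibre map `ex_i (t, ·)` is an ADDITIVE marking `φt` of
the fibre read in the total space»: `φt 0 = 1` lies over `ε`), which is how the E6 closer consumes it.

* §1 `left_comp_hom_eq_basePoint` (the point of `S` under `φA m` is `φS (p m)`), `eq_ex_zero_of_left_eq` (a point on the zero section IS the
  chart zero).
* §2 **`exists_isMonHom_of_chartReadings`** — THE HEAD.
* §3 **`exists_isMonHom_of_chartReadings_of_additive`** — the head with the (G)-clause zero hypothesis.
* §4 (ED. 2) `ex_apply_eq_of_fibreReadings` — the `hcompat` hypothesis of §2 FROM FIBRE READINGS: if the two chart fibre maps at `t` are read in the fibre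
  `A_s` by markings `u`, `u′` (the last (ADM) conjunct of ★ P-3) and the readings are compatible on the fibre (★ MRK-READ
  `SiegelAdelicMarking.toFun_cover_apply_eq_of_periodRel`), then the chart recipes are compatible in `MA`.

## References
* [BirkenhakeLange2004] C. Birkenhake, H. Lange, *Complex Abelian Varieties*, 2nd ed. (2004), §1.2 Proposition 1.2.1.
* [Shimura1963AnalyticFamilies] G. Shimura, *On analytic families of polarized abelian varieties and automorphic functions*, Ann. Math. 78 (1963), §2.
* [SerreGAGA1956] J.-P. Serre, *Géométrie algébrique et géométrie analytique*, Ann. Inst. Fourier 6 (1956), §3 Prop. 15.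
* [MumfordFogartyKirwan1994] D. Mumford, J. Fogarty, F. Kirwan, *Geometric Invariant Theory*, 3rd ed. (1994), Ch. 6 §1 Cor. 6.4 (p. 117),
  Definition 6.1 (p. 115).
-/

set_option autoImplicit false

noncomputable section

open scoped Manifold ContDiff
open CategoryTheory CategoryTheory.Limits AlgebraicGeometry
open Literature.NumberTheory.Transcendental (IsAnalytification)
open Literature.AlgebraicGeometry.Motives (SchemeOver AlgPoints ComplexPoints IsSmoothProjective)
open Literature.Geometry.ComplexAnalytic (IsRelExpChartOn totalOver projOver basePoint apply_basePoint)
open Literature.Geometry.Kaehler (ComplexTorus)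
open Literature.Geometry.Kaehler.ComplexTorus (cover)

namespace Literature.AlgebraicGeometry.AbelianSchemes.AbelianSchemeOver

/-! ### §1 Points of the total space over the analytic projection -/

section Points

variable {S : SchemeOver ℂ} (A : AbelianSchemeOver S.left) {n d : ℕ}
  {ES : Type} [NormedAddCommGroup ES] [NormedSpace ℂ ES] [FiniteDimensional ℂ ES]
  {MS : Type} [TopologicalSpace MS] [ChartedSpace ES MS] {φS : MS → ComplexPoints S} {MA : Type}
  {φA : MA → ComplexPoints (totalOver S A)}

/-- **The point of `S` under `φA m` is `φS` of its analytic base point** (★ `apply_basePoint` read on the left components).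
[cite: MumfordFogartyKirwan1994, Ch. 6 §1 Definition 6.1 (p. 115)] -/
theorem left_comp_hom_eq_basePoint (hS : IsAnalytification ES S d φS) (m : MA) :
    (φA m).left ≫ A.X.hom = (φS (basePoint hS A φA m)).left := by
  rw [apply_basePoint hS A φA m]
  rfl

variable {E : Type} [NormedAddCommGroup E] [NormedSpace ℂ E] [FiniteDimensional ℂ E] [TopologicalSpace MA] [ChartedSpace E MA]
  {Eg : Type} [NormedAddCommGroup Eg] {I : Type} {U : I → Set MS} {ex : I → MS × Eg → MA}

/-- **A point of `MA` on the zero section IS the zero of its chart**: if `φA m` lies on `ε` and the chart zero `ex_i (t, 0)` over `t := p m ∈ U_i`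
lies on `ε` too, then `m = ex_i (p m, 0)` (`φA` is injective; both are points of `T` with the same left component `φS (p m) ≫ ε`).
[cite: MumfordFogartyKirwan1994, Ch. 6 §1 Definition 6.1 (p. 115)] -/
theorem eq_ex_zero_of_left_eq (hS : IsAnalytification ES S d φS) (hφA : IsAnalytification E (totalOver S A) n φA)
    {i : I} (hzero : ∀ t ∈ U i, (φA (ex i (t, 0))).left = (φS t).left ≫ A.unitSection)
    {m : MA} (hm : basePoint hS A φA m ∈ U i) {s : Spec (.of ℂ) ⟶ S.left} (hs : (φA m).left = s ≫ A.unitSection) :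
    m = ex i (basePoint hS A φA m, 0) := by
  -- `s` is the base point of `m`
  have hclean : (s ≫ A.unitSection) ≫ A.X.hom = s := by
    rw [Category.assoc, A.unitSection_comp_hom, Category.comp_id]
  have h2 : (φA m).left ≫ A.X.hom = s := (congrArg (· ≫ A.X.hom) hs).trans hclean
  have hsb : s = (φS (basePoint hS A φA m)).left := h2.symm.trans (left_comp_hom_eq_basePoint A hS m)
  apply hφA.isHomeomorph.injective
  apply Over.OverMorphism.ext
  rw [hs, hsb, hzero _ hm]
  rfl

end Points

/-! ### §2 HEAD: the endomorphism of compatible chart readings -/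

variable {S : SchemeOver ℂ} [LocallyOfFiniteType S.hom] [IsSeparated S.hom] (A : AbelianSchemeOver S.left) {n d : ℕ}
  {ES : Type} [NormedAddCommGroup ES] [NormedSpace ℂ ES] [FiniteDimensional ℂ ES]
  {MS : Type} [TopologicalSpace MS] [ChartedSpace ES MS] {φS : MS → ComplexPoints S}
  {E : Type} [NormedAddCommGroup E] [NormedSpace ℂ E] [FiniteDimensional ℂ E]
  {MA : Type} [TopologicalSpace MA] [ChartedSpace E MA] [IsManifold 𝓘(ℂ, E) ω MA]
  {φA : MA → ComplexPoints (totalOver S A)}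
  {Eg : Type} [NormedAddCommGroup Eg] [NormedSpace ℂ Eg] {κ : Type}
  {I : Type} {U : I → Set MS} {Φ : I → MS → ((κ → ℝ) ≃L[ℝ] Eg)} {ex : I → MS × Eg → MA}

/-- **AN ENDOMORPHISM OF THE ABELIAN SCHEME FROM COMPATIBLE CHART READINGS** ([BirkenhakeLange2004] Prop. 1.2.1 in the family + GAGA + rigidity).
`A → S` an abelian scheme over a reduced separated complex variety with smooth projective total space `T`, analytifications `φS`, `φA`,
analytic projection `p := basePoint`; `(Φ_i, ex_i)` relative exponential charts of `p` over opens `U_i` COVERING `MS` whose zeros `ex_i (t, 0)`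
lie on the zero section; `C_i t : E_g →L[ℂ] E_g` holomorphic on `U_i`, carrying periods to periods, COMPATIBLE ON THE FIBRES over the
overlaps.  THEN there is an `S`-endomorphism `Y : A.X ⟶ A.X`, a HOMOMORPHISM of `S`-group schemes, which induces every chart recipe:
`(φA (ex_i (t, C_i t z))).left = (φA (ex_i (t, z))).left ≫ Y.left` (`t ∈ U_i`).  Glue by ★ U6-b′ `exists_mdifferentiable_of_cover`, then ★ E6-an
`exists_isMonHom_of_mdifferentiable` (over `S` on points since `p ∘ y = p`; fixes the zero section by §1 and `C_i t 0 = 0`).  In E6: `S = X_ℂ` the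
record curve, `A = P.A ×_X X_ℂ`, the charts = ★ P-3 over the lift domains, `C_i t` = the avatar of `Mρ a b`.
[cite: BirkenhakeLange2004, §1.2 Proposition 1.2.1] [cite: Shimura1963AnalyticFamilies, §2] [cite: SerreGAGA1956, §3 Prop. 15]
[cite: MumfordFogartyKirwan1994, Ch. 6 §1 Corollary 6.4 (p. 117)] -/
theorem exists_isMonHom_of_chartReadings [IsReduced S.left] (hT : IsSmoothProjective n (totalOver S A))
    (hS : IsAnalytification ES S d φS) (hφA : IsAnalytification E (totalOver S A) n φA)
    (hex : ∀ i, IsRelExpChartOn ES E (basePoint hS A φA) (U i) (Φ i) (ex i)) (hcov : ∀ t : MS, ∃ i, t ∈ U i)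
    (hzero : ∀ i, ∀ t ∈ U i, (φA (ex i (t, 0))).left = (φS t).left ≫ A.unitSection)
    (C : I → MS → (Eg →L[ℂ] Eg)) (hC : ∀ i, MDifferentiableOn 𝓘(ℂ, ES) 𝓘(ℂ, Eg →L[ℂ] Eg) (C i) (U i))
    (N : I → MS → ((κ → ℤ) → (κ → ℤ)))
    (hN : ∀ i, ∀ t ∈ U i, ∀ n : κ → ℤ, C i t (Φ i t (fun k => (n k : ℝ))) = Φ i t (fun k => (N i t n k : ℝ)))
    (hcompat : ∀ i j, ∀ t ∈ U i ∩ U j, ∀ z z' : Eg, ex i (t, z) = ex j (t, z') → ex i (t, C i t z) = ex j (t, C j t z')) :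
    ∃ Y : A.X ⟶ A.X, IsMonHom Y ∧
      ∀ i, ∀ t ∈ U i, ∀ z : Eg, (φA (ex i (t, C i t z))).left = (φA (ex i (t, z))).left ≫ Y.left := by
  -- continuity of the analytic projection `p = φS⁻¹ ∘ π ∘ φA`
  have hp : Continuous (basePoint hS A φA) :=
    hS.homeomorph.symm.continuous.comp ((AlgPoints.continuous_map _).comp hφA.isHomeomorph.continuous)
  -- §1 GLUE the chartwise holomorphic maps (★ U6-b′ over ★ U6-b)
  obtain ⟨y, hy, hpy, hdy⟩ := IsRelExpChartOn.exists_mdifferentiable_of_cover hex hex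
    (fun m => hcov (basePoint hS A φA m)) hp C hC N hN hcompat
  -- `y` lies over `S` on points
  have hover : ∀ m, (φA (y m)).left ≫ A.X.hom = (φA m).left ≫ A.X.hom := fun m => by
    rw [left_comp_hom_eq_basePoint A hS, left_comp_hom_eq_basePoint A hS, hpy]
  -- `y` fixes the zero section: a point on it is a chart zero, and `C i t 0 = 0`
  have hfix : ∀ m, (∃ s : Spec (.of ℂ) ⟶ S.left, (φA m).left = s ≫ A.unitSection) → y m = m := by
    rintro m ⟨s, hs⟩
    obtain ⟨i, hi⟩ := hcov (basePoint hS A φA m)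
    have hm0 := eq_ex_zero_of_left_eq A hS hφA (hzero i) hi hs
    have key : y (ex i (basePoint hS A φA m, 0)) = ex i (basePoint hS A φA m, 0) := by
      rw [hy i _ hi, map_zero]
    rwa [← hm0] at key
  -- §2 GAGA + rigidity (★ E6-an)
  obtain ⟨Y, hYm, hY⟩ := A.exists_isMonHom_of_mdifferentiable hT hφA hdy hover hfix
  refine ⟨Y, hYm, fun i t ht z => ?_⟩
  rw [← hy i t ht z]
  exact hY (ex i (t, z))

/-! ### §3 The head with the (G)-clause zero hypothesis (additive fibre markings read in the total space) -/

/-- `π 0 = 0` for the covering map of ★ `ComplexTorus` (local copy of the one-liner, to keep the imports light). [folklore] -/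
private theorem cover_zero' (Ψ : (κ → ℝ) ≃L[ℝ] Eg) : cover Ψ (0 : Eg) = 0 := by
  rw [ComplexTorus.cover_apply, map_zero]
  exact funext fun _ => rfl

/-- **THE HEAD IN (G)-CLAUSE FORM** (the shape ★ P-1 `relativeExponentialUniformisation` ∕ ★ P-3 `siegelUniversalFamilyUniformisation` deliver):
if every chart fibre map `ex_i (t, ·)` is, read in the total space, an ADDITIVE marking `φt` of the fibre `A_{φS t}`
(`(φA (ex_i (t, z))).left = fibrePointToLeft (φS t) (φt (π z))`, `φt (x + y) = φt x * φt y`), then the chart zeros lie on the zero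
section (`φt 0 = 1` ↦ `φS t ≫ ε`, ★ `fibrePointToLeft_one`) and §2 applies: compatible period-preserving holomorphic linear families on a
cover give an `S`-endomorphism `Y`, a homomorphism, inducing every chart recipe.
[cite: BirkenhakeLange2004, §1.2 Proposition 1.2.1] [cite: Shimura1963AnalyticFamilies, §2] [cite: SerreGAGA1956, §3 Prop. 15]
[cite: MumfordFogartyKirwan1994, Ch. 6 §1 Corollary 6.4 (p. 117) and Definition 6.1 (p. 115)] -/
theorem exists_isMonHom_of_chartReadings_of_additive [IsReduced S.left] (hT : IsSmoothProjective n (totalOver S A))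
    (hS : IsAnalytification ES S d φS) (hφA : IsAnalytification E (totalOver S A) n φA)
    (hex : ∀ i, IsRelExpChartOn ES E (basePoint hS A φA) (U i) (Φ i) (ex i)) (hcov : ∀ t : MS, ∃ i, t ∈ U i)
    (hG : ∀ i, ∀ t ∈ U i, ∃ φt : ComplexTorus (Φ i t) → (A.fibre (φS t).left).toAbelianVariety.Points ℂ,
      (∀ x y, φt (x + y) = φt x * φt y) ∧
      ∀ z : Eg, (φA (ex i (t, z))).left = A.fibrePointToLeft (φS t).left (φt (cover (Φ i t) z)))
    (C : I → MS → (Eg →L[ℂ] Eg)) (hC : ∀ i, MDifferentiableOn 𝓘(ℂ, ES) 𝓘(ℂ, Eg →L[ℂ] Eg) (C i) (U i))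
    (N : I → MS → ((κ → ℤ) → (κ → ℤ)))
    (hN : ∀ i, ∀ t ∈ U i, ∀ n : κ → ℤ, C i t (Φ i t (fun k => (n k : ℝ))) = Φ i t (fun k => (N i t n k : ℝ)))
    (hcompat : ∀ i j, ∀ t ∈ U i ∩ U j, ∀ z z' : Eg, ex i (t, z) = ex j (t, z') → ex i (t, C i t z) = ex j (t, C j t z')) :
    ∃ Y : A.X ⟶ A.X, IsMonHom Y ∧
      ∀ i, ∀ t ∈ U i, ∀ z : Eg, (φA (ex i (t, C i t z))).left = (φA (ex i (t, z))).left ≫ Y.left := by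
  refine A.exists_isMonHom_of_chartReadings hT hS hφA hex hcov (fun i t ht => ?_) C hC N hN hcompat
  obtain ⟨φt, hadd, hread⟩ := hG i t ht
  -- `φt 0 = 1`
  have h0 : φt 0 = 1 := by
    have h := hadd 0 0
    rw [add_zero] at h
    exact (mul_eq_left.mp h.symm)
  rw [hread 0, cover_zero', h0]
  exact DualPair.fibrePointToLeft_one (A := A) _

/-! ### §4 (ED. 2) The compatibility hypothesis from fibre readings -/

omit [LocallyOfFiniteType S.hom] [IsSeparated S.hom] [IsManifold 𝓘(ℂ, E) ω MA] [NormedAddCommGroup Eg] [NormedSpace ℂ Eg] [TopologicalSpace MS] in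
/-- **`hcompat` FROM FIBRE READINGS.**  At a base point `t` let the fibre maps of two charts `ex_i (t, ·)`, `ex_j (t, ·)` be READ in the algebraic fibre `A_s`
through maps `u, u′ : E_g → A_s(ℂ)` (`fibrePointToLeft s (u z) = φA (ex_i (t, z))` — the last (ADM) conjunct of ★ P-3 with `u = m.toFun ∘ π`), and let the readings
be compatible on the fibre: `u z = u′ z′ → u (C z) = u′ (C′ z′)` (★ MRK-READ).  Then the chart recipes are compatible in `MA`:
`ex_i (t, z) = ex_j (t, z′) → ex_i (t, C z) = ex_j (t, C′ z′)` — the `hcompat` hypothesis of §2 at `t` (`φA` and `fibrePointToLeft s` are injective).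
[cite: BirkenhakeLange2004, §1.2 Proposition 1.2.1] [cite: MumfordFogartyKirwan1994, Ch. 6 §1 Definition 6.1 (p. 115)] -/
theorem ex_apply_eq_of_fibreReadings (hφA : IsAnalytification E (totalOver S A) n φA) {i j : I} {t : MS}
    {s : Spec (.of ℂ) ⟶ S.left} (u u' : Eg → (A.fibre s).toAbelianVariety.Points ℂ)
    (hu : ∀ z : Eg, A.fibrePointToLeft s (u z) = (φA (ex i (t, z))).left)
    (hu' : ∀ z' : Eg, A.fibrePointToLeft s (u' z') = (φA (ex j (t, z'))).left)
    {C C' : Eg → Eg} (hread : ∀ z z' : Eg, u z = u' z' → u (C z) = u' (C' z'))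
    {z z' : Eg} (h : ex i (t, z) = ex j (t, z')) : ex i (t, C z) = ex j (t, C' z') := by
  -- read the hypothesis in the fibre
  have h1 : u z = u' z' := A.fibrePointToLeft_injective s (by rw [hu, hu', h])
  -- transport the reading and come back
  have h2 : (φA (ex i (t, C z))).left = (φA (ex j (t, C' z'))).left := by rw [← hu, ← hu', hread z z' h1]
  exact hφA.isHomeomorph.injective (Over.OverMorphism.ext h2)

end Literature.AlgebraicGeometry.AbelianSchemes.AbelianSchemeOver

end
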